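import Summits.BirchSwinnertonDyer.BirchSwinnertonDyer.Theorems.EisensteinPrimesSplitMultAlgebraicSide
import Summits.BirchSwinnertonDyer.BirchSwinnertonDyer.Theorems.EisensteinPrimesSplitMultLambdaLEOfSurC
import Summits.BirchSwinnertonDyer.BirchSwinnertonDyer.Theorems.EisensteinPrimesSplitMultCharImprimitiveShiftOfSurC
import HarnessLib

/-!
# Crux 4 `BSDpOnCellC` (stmt-BirchSwinnertonDyer-19034) — «OfSurC» re-typing, files 6–7: THE ALGEBRAIC SIDE OF THE SPLIT CONJUNCT
# (`SplitMultSfTransfer.lambdaInvariant_add_le_of_split_offP`, `SplitMultAlgebraicSide.lambdaInvariant_primitive_add_sum_le_of_split`)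
# with Greenberg 2016 Prop. 2.6.3 BY NAME ↦ its CASE (c) AT TOTALLY COMPLEX FIELDS BY NAME (`prop263_sur_of_crk_caseC_tc`)

Cell `bsd-eis` (run/shared/lean/pub/bsd-eis/), width seat `bsd-line-x2-p2` gen 16; `--supports stmt-BirchSwinnertonDyer-19034`
(helper; closes nothing; skeleton of record crystal v10 UNCHANGED, W-79). Sequel of `…SplitMultLambdaLEOfSurC` (p718129; module
docstring there: why crux 4's consumers of `prop263_sur_of_crk` are re-typed onto the case-(c)-TC statement read by crux 2 and by
road «SUR-Λ») and `…SplitMultCharImprimitiveShiftOfSurC` (p718299).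

WHAT. Statements VERBATIM (same binders, order, conclusions) except `(h263 : prop263_sur_of_crk_caseC_tc)`; names `<name>_ofSurC`;
proofs = the tree proofs with the h263-callees replaced by their `_ofSurC` twins (`SplitMultLambdaLE.lambdaInvariant_add_le_of_split_ofSurC`,
`SplitMultCharImprimitiveShift.imprimitive_clauses_of_split_ofSurC` — the latter without its dropped `h32` argument).
* `SplitMultSfTransfer.lambdaInvariant_add_le_of_split_offP_ofSurC` — KY Thm. 1.4.1 (iii) `≤` half at a split multiplicative prime in line
  b1's currency (`Sf` off `p`): `λ(DSsub.X) + λ(DSquot.X) ≤ λ(𝔛^{Sf}_f) + [θquot = 𝟙]`.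
* `SplitMultAlgebraicSide.lambdaInvariant_primitive_add_sum_le_of_split_ofSurC` — primitive currency:
  `λ(Dsub.X) + λ(Dquot.X) + Σ_{w∈Sf}(λ𝒫_w(θsub) + λ𝒫_w(θquot)) ≤ λ(𝔛^{Sf}_f) + [θquot = 𝟙]`.

HONEST FRAMING: theorems only (0 defs, 0 named facts, 0 sorry, 0 instances); CONDITIONAL on the published named facts carried as
hypotheses; closes no stub; no summit statement / BSD / MC / IMC / Keller–Yin theorem is proved for any curve; 0 cells / labels / tiers move.

References: [KellerYin2024] Thm. 1.4.1 (iii), Prop. 1.2.5, Lemma 5.1.1, §1.3–§1.4, §5.1 (arXiv:2402.12781v2); [CastellaGrossiLeeSkinner2022]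
Prop. 1.2.5, proof of Thm. 1.5.1 (eq:lambda-imp); [Greenberg2016Selmer] Prop. 2.6.3 (c); [Greenberg2010] Prop. 3.2.1 (c); [GreenbergVatsal2000]
§2 pp. 14–15, 20; [Greenberg2006] Props. 3.2, 4.1, 4.2, §5 A; [NeukirchSchmidtWingberg2008] (8.3.18); [Castella2018] Def. 2.2.
-/

set_option autoImplicit false
-- the route's Theorems namespace repeats the summit name by design (D-0017 nested layout)
set_option linter.dupNamespace false

noncomputable section

open scoped Classical

namespace Summit.BirchSwinnertonDyer.BirchSwinnertonDyer.Theorems.SplitMultSfTransfer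

open PowerSeries WeierstrassCurve NumberField IsDedekindDomain Field
  Literature.NumberTheory.GaloisRepresentations Literature.NumberTheory.EllipticCurves.GreenbergVatsal2000
  Literature.NumberTheory.EllipticCurves Literature.NumberTheory.EllipticCurves.Rank1Residual
  Literature.NumberTheory.EllipticCurves.Castella2018 Literature.NumberTheory.EllipticCurves.GreenbergSelmer
  Literature.NumberTheory.QuadraticFields Literature.NumberTheory.EllipticCurves.KellerYin2024
  Literature.NumberTheory.EllipticCurves.IwasawaAlgebra Literature.NumberTheory.IwasawaTheory
  Literature.NumberTheory.IwasawaTheory.Greenberg2016 Literature.NumberTheory.IwasawaTheory.Greenberg2006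
  Literature.NumberTheory.GaloisCohomology
  Summit.BirchSwinnertonDyer.Rank1Residual.X2.ResidualDevissageModules
  Summit.BirchSwinnertonDyer.BirchSwinnertonDyer.Theorems

/-- **[«OfSurC» re-typing: Greenberg 2016 Prop. 2.6.3 by name ↦ its case (c) at totally complex `K` by name (`prop263_sur_of_crk_caseC_tc`).]**
**Keller–Yin's anomalous `λ`-inequality (Thm. 1.4.1 (iii), `≤` half) AT A SPLIT MULTIPLICATIVE EISENSTEIN PRIME IN LINE b1's CURRENCY** —
`lambdaInvariant_add_le_of_split_offP` VERBATIM (every object over `Sf` = places over `N` off `p`): `λ(DSsub.X) + λ(DSquot.X) ≤ λ(𝔛^{Sf}_f) + [θquot = 𝟙]`;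
proof: the `Sf ∪ {v, v̄}` statement `SplitMultLambdaLE.lambdaInvariant_add_le_of_split_ofSurC` and the tree's §1–§3 transfers off `p`.
[cite: KellerYin2024, Thm. 1.4.1 (iii), §1.3–§1.4 Cases I–III, §5.1 (arXiv:2402.12781v2 TeX L1087–1330, L1725–1769)]
[cite: GreenbergVatsal2000, §2 pp. 14–15, 20] [cite: Greenberg2016Selmer, Prop. 2.6.3 (c)] [cite: Greenberg2010, Prop. 3.2.1 (c) (p. 15)]
[cite: Greenberg2006, Props. 3.2, 4.1, 4.2, §5 A] [cite: NeukirchSchmidtWingberg2008, (8.3.18)] [cite: Castella2018, Def. 2.2] -/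
theorem lambdaInvariant_add_le_of_split_offP_ofSurC (h263 : prop263_sur_of_crk_caseC_tc) (h41 : prop41_globalEulerPoincareCorank)
    (h42 : prop42_localEulerPoincareCorank) (h5A : sec5A_localH2_subsingleton_of_LOC1)
    (h32 : prop32_cohomology_isCofinitelyGenerated)
    (W : WeierstrassCurve ℚ) [W.IsElliptic] [W.IsGloballyMinimal] (p : ℕ) [Fact p.Prime]
    (hp : 2 < p) (hsplitred : W.HasSplitMultiplicativeReductionAtPrime p)
    (K : Type) [Field K] [NumberField K] (hK : IsImaginaryQuadratic K)
    (hCD2 : groupCdLE_two_galoisGroupUnramifiedOutside K)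
    (hH : SatisfiesHeegnerHypothesis (W.conductorNorm ℤ) K)
    (hsplit : ((Ideal.span {(p : ℤ)}).primesOver (𝓞 K)).ncard = 2)
    (htor : ∀ Q : (W.baseChange K).toAffine.Point, p • Q = 0 → Q = 0)
    (ι : K →+* ℚ_[p]) (v vbar : HeightOneSpectrum (𝓞 K))
    (hv : ∀ x : 𝓞 K, x ∈ v.asIdeal ↔ ‖ι (x : K)‖ < 1)
    (hvbar : ((p : ℕ) : 𝓞 K) ∈ vbar.asIdeal) (hne : vbar ≠ v)
    (κ : ZpExtension K p) (hκ : κ.IsAnticyclotomic)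
    (γ : absoluteGaloisGroup K) [Fact (κ.IsTopGenerator γ)]
    (θsub θquot : FramedGaloisRep K (padicCoeffIntegers (∅ : Set (PadicAlgCl p))) 1)
    (hpair : IsResidualPairOver (W.baseChange K) p θsub θquot)
    (hramI : ∃ τ ∈ inertia vbar, unitChar θsub τ ≠ 1)
    (Sf : Finset (HeightOneSpectrum (𝓞 K)))
    (hSf : ∀ w : HeightOneSpectrum (𝓞 K), w ∈ Sf ↔
      (((W.conductorNorm ℤ : ℤ) : 𝓞 K) ∈ w.asIdeal ∧ ((p : ℕ) : 𝓞 K) ∉ w.asIdeal))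
    (DSsub : DatumDualData κ γ (charModule ∅ θsub)
        (AcSelmer.bdpData (charModule ∅ θsub) p vbar) (↑Sf : Set (HeightOneSpectrum (𝓞 K))))
    (DSquot : DatumDualData κ γ (charModule ∅ θquot)
        (AcSelmer.bdpData (charModule ∅ θquot) p vbar) (↑Sf : Set (HeightOneSpectrum (𝓞 K))))
    (hfgS : Module.Finite (IwasawaAlgebra p) (AcSelmer.XAc (W.baseChange K) p κ vbar (↑Sf : Set (HeightOneSpectrum (𝓞 K))) γ))
    (htorS : Module.IsTorsion (IwasawaAlgebra p) (AcSelmer.XAc (W.baseChange K) p κ vbar (↑Sf : Set (HeightOneSpectrum (𝓞 K))) γ))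
    (hμS : muInvariant p (AcSelmer.XAc (W.baseChange K) p κ vbar (↑Sf : Set (HeightOneSpectrum (𝓞 K))) γ) = 0)
    (hSsub : ∀ D : DatumDualData κ γ (charModule ∅ θsub)
        (AcSelmer.bdpData (charModule ∅ θsub) p vbar) (↑Sf : Set (HeightOneSpectrum (𝓞 K))),
      Module.Finite (IwasawaAlgebra p) D.X ∧ Module.IsTorsion (IwasawaAlgebra p) D.X ∧ muInvariant p D.X = 0)
    (hSquot : ∀ D : DatumDualData κ γ (charModule ∅ θquot)
        (AcSelmer.bdpData (charModule ∅ θquot) p vbar) (↑Sf : Set (HeightOneSpectrum (𝓞 K))),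
      Module.Finite (IwasawaAlgebra p) D.X ∧ Module.IsTorsion (IwasawaAlgebra p) D.X ∧ muInvariant p D.X = 0) :
    lambdaInvariant p DSsub.X + lambdaInvariant p DSquot.X ≤
      lambdaInvariant p (AcSelmer.XAc (W.baseChange K) p κ vbar (↑Sf : Set (HeightOneSpectrum (𝓞 K))) γ) +
        (if ∀ σ : absoluteGaloisGroup K, θquot σ = 1 then 1 else 0) := by
  have hpv : ((p : ℕ) : 𝓞 K) ∈ v.asIdeal := IndexPlumbingNrVsStrict.natCast_mem_asIdeal_of_forall_norm_iff hv
  -- the x1-convention set `SN = Sf ∪ {v, v̄}` and its agreement with `Sf` off `p`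
  set SN : Finset (HeightOneSpectrum (𝓞 K)) := insert v (insert vbar Sf) with hSNdef
  have hSp : ∀ w : HeightOneSpectrum (𝓞 K), ((p : ℕ) : 𝓞 K) ∈ w.asIdeal →
      w ∈ (↑(insert v (insert vbar Sf)) : Set (HeightOneSpectrum (𝓞 K))) :=
    AcTwistDeformationResidualPair.mem_insert_insert_of_natCast_mem hK hpv hvbar hne Sf
  have hSN : ∀ w : HeightOneSpectrum (𝓞 K), w ∈ SN ↔ ((W.conductorNorm ℤ : ℤ) : 𝓞 K) ∈ w.asIdeal := by
    intro w
    constructor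
    · intro hw
      rw [hSNdef, Finset.mem_insert, Finset.mem_insert] at hw
      rcases hw with rfl | rfl | hw
      · exact conductorNorm_mem_of_natCast_mem W hsplitred hpv
      · exact conductorNorm_mem_of_natCast_mem W hsplitred hvbar
      · exact ((hSf w).mp hw).1
    · intro hN
      by_cases hpw : ((p : ℕ) : 𝓞 K) ∈ w.asIdeal
      · have h := hSp w hpw
        rw [Finset.mem_coe] at h
        rw [hSNdef]; exact h
      · rw [hSNdef, Finset.mem_insert, Finset.mem_insert]
        exact Or.inr (Or.inr ((hSf w).mpr ⟨hN, hpw⟩))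
  have hoff : ∀ w : HeightOneSpectrum (𝓞 K), ((p : ℕ) : 𝓞 K) ∉ w.asIdeal →
      (w ∈ (↑Sf : Set (HeightOneSpectrum (𝓞 K))) ↔ w ∈ (↑SN : Set (HeightOneSpectrum (𝓞 K)))) := by
    intro w hpw
    rw [Finset.mem_coe, Finset.mem_coe, hSNdef, Finset.mem_insert, Finset.mem_insert]
    constructor
    · exact fun hw ↦ Or.inr (Or.inr hw)
    · rintro (rfl | rfl | hw)
      · exact absurd hpv hpw
      · exact absurd hvbar hpw
      · exact hw
  have hoff' : ∀ w : HeightOneSpectrum (𝓞 K), ((p : ℕ) : 𝓞 K) ∉ w.asIdeal →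
      (w ∈ (↑SN : Set (HeightOneSpectrum (𝓞 K))) ↔ w ∈ (↑Sf : Set (HeightOneSpectrum (𝓞 K)))) :=
    fun w hpw ↦ (hoff w hpw).symm
  -- transfer of the curve-side invariants `Sf → SN`
  haveI hEK : (W.baseChange K).IsElliptic := inferInstanceAs (W.map (algebraMap ℚ K)).IsElliptic
  have hsel : AcSelmer.selmerAc (W.baseChange K) p κ vbar (↑Sf : Set (HeightOneSpectrum (𝓞 K))) =
      AcSelmer.selmerAc (W.baseChange K) p κ vbar (↑SN : Set (HeightOneSpectrum (𝓞 K))) :=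
    selmerAc_congr_offP κ (W.baseChange K) vbar hoff
  obtain ⟨hfgT, htorT, hμT, hlamT⟩ := xAc_invariants_congr (W.baseChange K) p κ vbar γ hsel
  have hfgS' := hfgT hfgS
  have htorS' := htorT htorS
  have hμS' : muInvariant p (AcSelmer.XAc (W.baseChange K) p κ vbar (↑SN : Set (HeightOneSpectrum (𝓞 K))) γ) = 0 := by
    rw [← hμT]; exact hμS
  -- transfer of the character-side `∀ D` clauses `Sf → SN`
  have hSsub' : ∀ D : DatumDualData κ γ (charModule ∅ θsub)
      (AcSelmer.bdpData (charModule ∅ θsub) p vbar) (↑SN : Set (HeightOneSpectrum (𝓞 K))),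
      Module.Finite (IwasawaAlgebra p) D.X ∧ Module.IsTorsion (IwasawaAlgebra p) D.X ∧ muInvariant p D.X = 0 := fun D ↦
    prop_datumDualData_congr_offP κ (AcSelmer.bdpData (charModule ∅ θsub) p vbar) hoff'
      (fun X _ _ ↦ Module.Finite (IwasawaAlgebra p) X ∧ Module.IsTorsion (IwasawaAlgebra p) X ∧ muInvariant p X = 0) hSsub D
  have hSquot' : ∀ D : DatumDualData κ γ (charModule ∅ θquot)
      (AcSelmer.bdpData (charModule ∅ θquot) p vbar) (↑SN : Set (HeightOneSpectrum (𝓞 K))),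
      Module.Finite (IwasawaAlgebra p) D.X ∧ Module.IsTorsion (IwasawaAlgebra p) D.X ∧ muInvariant p D.X = 0 := fun D ↦
    prop_datumDualData_congr_offP κ (AcSelmer.bdpData (charModule ∅ θquot) p vbar) hoff'
      (fun X _ _ ↦ Module.Finite (IwasawaAlgebra p) X ∧ Module.IsTorsion (IwasawaAlgebra p) X ∧ muInvariant p X = 0) hSquot D
  -- the `SN`-statement for every pair of `SN`-dual data
  have hmain : ∀ (D₁ : DatumDualData κ γ (charModule ∅ θsub)
        (AcSelmer.bdpData (charModule ∅ θsub) p vbar) (↑SN : Set (HeightOneSpectrum (𝓞 K))))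
      (D₃ : DatumDualData κ γ (charModule ∅ θquot)
        (AcSelmer.bdpData (charModule ∅ θquot) p vbar) (↑SN : Set (HeightOneSpectrum (𝓞 K)))),
      lambdaInvariant p D₁.X + lambdaInvariant p D₃.X ≤
        lambdaInvariant p (AcSelmer.XAc (W.baseChange K) p κ vbar (↑Sf : Set (HeightOneSpectrum (𝓞 K))) γ) +
          (if ∀ σ : absoluteGaloisGroup K, θquot σ = 1 then 1 else 0) := by
    intro D₁ D₃
    rw [hlamT]
    exact SplitMultLambdaLE.lambdaInvariant_add_le_of_split_ofSurC h263 h41 h42 h5A h32 W p hp hsplitred K hK hCD2 hH hsplit htor ι v vbar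
      hv hvbar hne κ hκ γ θsub θquot hpair hramI SN hSN D₁ D₃ hfgS' htorS' hμS' hSsub' hSquot'
  -- transfer of the conclusion `SN → Sf` (twice)
  exact prop_datumDualData_congr_offP κ (AcSelmer.bdpData (charModule ∅ θsub) p vbar) hoff
    (fun X _ _ ↦ lambdaInvariant p X + lambdaInvariant p DSquot.X ≤
      lambdaInvariant p (AcSelmer.XAc (W.baseChange K) p κ vbar (↑Sf : Set (HeightOneSpectrum (𝓞 K))) γ) +
        (if ∀ σ : absoluteGaloisGroup K, θquot σ = 1 then 1 else 0))
    (fun D₁ ↦ prop_datumDualData_congr_offP κ (AcSelmer.bdpData (charModule ∅ θquot) p vbar) hoff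
      (fun Y _ _ ↦ lambdaInvariant p D₁.X + lambdaInvariant p Y ≤
        lambdaInvariant p (AcSelmer.XAc (W.baseChange K) p κ vbar (↑Sf : Set (HeightOneSpectrum (𝓞 K))) γ) +
          (if ∀ σ : absoluteGaloisGroup K, θquot σ = 1 then 1 else 0))
      (fun D₃ ↦ hmain D₁ D₃) DSquot) DSsub

end Summit.BirchSwinnertonDyer.BirchSwinnertonDyer.Theorems.SplitMultSfTransfer

namespace Summit.BirchSwinnertonDyer.BirchSwinnertonDyer.Theorems.SplitMultAlgebraicSide

open NumberField IsDedekindDomain Field Multiplicative PowerSeries WeierstrassCurve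
open Literature.NumberTheory.EllipticCurves Literature.NumberTheory.EllipticCurves.GreenbergSelmer
  Literature.NumberTheory.EllipticCurves.GreenbergVatsal2000 Literature.NumberTheory.GaloisRepresentations
  Literature.NumberTheory.EllipticCurves.KellerYin2024 Literature.NumberTheory.EllipticCurves.IwasawaDual
  Literature.NumberTheory.IwasawaTheory Literature.NumberTheory.IwasawaTheory.Greenberg2016
  Literature.NumberTheory.IwasawaTheory.Greenberg2006 Literature.NumberTheory.EllipticCurves.Castella2018
  Literature.NumberTheory.GaloisCohomology
  Summit.BirchSwinnertonDyer.BirchSwinnertonDyer.Theorems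

variable {K : Type} [Field K] [NumberField K] {p : ℕ} [hp : Fact p.Prime]

/-- **[«OfSurC» re-typing: Greenberg 2016 Prop. 2.6.3 by name ↦ its case (c) at totally complex `K` by name (`prop263_sur_of_crk_caseC_tc`).]**
**THE ALGEBRAIC SIDE OF THE SPLIT CONJUNCT, PRIMITIVE CURRENCY** — `lambdaInvariant_primitive_add_sum_le_of_split` VERBATIM:
`λ(Dsub.X) + λ(Dquot.X) + Σ_{w∈Sf}(λ𝒫_w(θsub) + λ𝒫_w(θquot)) ≤ λ(𝔛^{Sf}_f) + [θquot = 𝟙]` from [RH] for both characters, Keller–Yin Lemma 5.1.1's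
cotorsion clause and the PUB facts; proof: `imprimitive_clauses_of_split_ofSurC` (both characters) + `lambdaInvariant_add_le_of_split_offP_ofSurC`.
[cite: KellerYin2024, Thm. 1.4.1 (iii), Prop. 1.2.5, Lemma 5.1.1, §5.1 (arXiv:2402.12781v2)] [cite: CastellaGrossiLeeSkinner2022, Prop. 1.2.5, proof of Thm. 1.5.1 (eq:lambda-imp)]
[cite: Greenberg2016Selmer, Prop. 2.6.3 (c)] [cite: Greenberg2010, Prop. 3.2.1 (c) (p. 15)] [cite: Greenberg2006, Props. 3.2, 4.1, 4.2, §5 A] [cite: NeukirchSchmidtWingberg2008, (8.3.18)] -/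
theorem lambdaInvariant_primitive_add_sum_le_of_split_ofSurC (h263 : prop263_sur_of_crk_caseC_tc) (h41 : prop41_globalEulerPoincareCorank)
    (h42 : prop42_localEulerPoincareCorank) (h5A : sec5A_localH2_subsingleton_of_LOC1)
    (h32 : prop32_cohomology_isCofinitelyGenerated)
    (W : WeierstrassCurve ℚ) [W.IsElliptic] [W.IsGloballyMinimal]
    (hp : 2 < p) (hsplitred : W.HasSplitMultiplicativeReductionAtPrime p)
    (hK : IsImaginaryQuadratic K) (hCD2 : groupCdLE_two_galoisGroupUnramifiedOutside K)
    (hH : SatisfiesHeegnerHypothesis (W.conductorNorm ℤ) K)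
    (hsplit : ((Ideal.span {(p : ℤ)}).primesOver (𝓞 K)).ncard = 2)
    (htor : ∀ Q : (W.baseChange K).toAffine.Point, p • Q = 0 → Q = 0)
    (ι : K →+* ℚ_[p]) (v vbar : HeightOneSpectrum (𝓞 K))
    (hv : ∀ x : 𝓞 K, x ∈ v.asIdeal ↔ ‖ι (x : K)‖ < 1)
    (hvbar : ((p : ℕ) : 𝓞 K) ∈ vbar.asIdeal) (hne : vbar ≠ v)
    (κ : ZpExtension K p) (hκ : κ.IsAnticyclotomic)
    (γ : absoluteGaloisGroup K) [Fact (κ.IsTopGenerator γ)]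
    (θsub θquot : FramedGaloisRep K (padicCoeffIntegers (∅ : Set (PadicAlgCl p))) 1)
    (hpair : IsResidualPairOver (W.baseChange K) p θsub θquot)
    (hramI : ∃ τ ∈ inertia vbar, unitChar θsub τ ≠ 1)
    (Sf : Finset (HeightOneSpectrum (𝓞 K)))
    (hSf : ∀ w : HeightOneSpectrum (𝓞 K), w ∈ Sf ↔
      (((W.conductorNorm ℤ : ℤ) : 𝓞 K) ∈ w.asIdeal ∧ ((p : ℕ) : 𝓞 K) ∉ w.asIdeal))
    (Dsub : DatumDualData κ γ (charModule ∅ θsub)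
        (AcSelmer.bdpData (charModule ∅ θsub) p vbar) (∅ : Set (HeightOneSpectrum (𝓞 K))))
    (Dquot : DatumDualData κ γ (charModule ∅ θquot)
        (AcSelmer.bdpData (charModule ∅ θquot) p vbar) (∅ : Set (HeightOneSpectrum (𝓞 K))))
    (hfgS : Module.Finite (IwasawaAlgebra p) (AcSelmer.XAc (W.baseChange K) p κ vbar (↑Sf : Set (HeightOneSpectrum (𝓞 K))) γ))
    (htorS : Module.IsTorsion (IwasawaAlgebra p) (AcSelmer.XAc (W.baseChange K) p κ vbar (↑Sf : Set (HeightOneSpectrum (𝓞 K))) γ))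
    (hμS : muInvariant p (AcSelmer.XAc (W.baseChange K) p κ vbar (↑Sf : Set (HeightOneSpectrum (𝓞 K))) γ) = 0)
    (hRHsub : ∀ D : DatumDualData κ γ (charModule ∅ θsub)
        (AcSelmer.bdpData (charModule ∅ θsub) p vbar) (∅ : Set (HeightOneSpectrum (𝓞 K))),
      Module.Finite (IwasawaAlgebra p) D.X ∧ Module.IsTorsion (IwasawaAlgebra p) D.X ∧ muInvariant p D.X = 0)
    (hRHquot : ∀ D : DatumDualData κ γ (charModule ∅ θquot)
        (AcSelmer.bdpData (charModule ∅ θquot) p vbar) (∅ : Set (HeightOneSpectrum (𝓞 K))),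
      Module.Finite (IwasawaAlgebra p) D.X ∧ Module.IsTorsion (IwasawaAlgebra p) D.X ∧ muInvariant p D.X = 0) :
    lambdaInvariant p Dsub.X + lambdaInvariant p Dquot.X +
        ∑ w ∈ Sf, (charLocalLambda ∅ κ θsub w + charLocalLambda ∅ κ θquot w) ≤
      lambdaInvariant p (AcSelmer.XAc (W.baseChange K) p κ vbar (↑Sf : Set (HeightOneSpectrum (𝓞 K))) γ) +
        (if ∀ σ : absoluteGaloisGroup K, θquot σ = 1 then 1 else 0) := by
  have hγ : κ.IsTopGenerator γ := Fact.out
  -- imprimitive dual data over `Sf` exist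
  obtain ⟨DSsub⟩ := nonempty_unrDualData_char (∅ : Set (PadicAlgCl p)) θsub κ vbar (↑Sf : Set (HeightOneSpectrum (𝓞 K))) hγ
  obtain ⟨DSquot⟩ := nonempty_unrDualData_char (∅ : Set (PadicAlgCl p)) θquot κ vbar (↑Sf : Set (HeightOneSpectrum (𝓞 K))) hγ
  -- Prop. 1.2.5 at the split datum for both characters: cotorsion of every imprimitive datum and the `λ`-shifts
  have hsubP := fun DS ↦ SplitMultCharImprimitiveShift.imprimitive_clauses_of_split_ofSurC h263 h41 h42 h5A W hp hsplitred hK hH hv hvbar hne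
    κ hκ γ hpair Sf hSf θsub (Or.inl rfl) hRHsub Dsub DS
  have hquotP := fun DS ↦ SplitMultCharImprimitiveShift.imprimitive_clauses_of_split_ofSurC h263 h41 h42 h5A W hp hsplitred hK hH hv hvbar hne
    κ hκ γ hpair Sf hSf θquot (Or.inr rfl) hRHquot Dquot DS
  have hSsub : ∀ DS : DatumDualData κ γ (charModule ∅ θsub)
      (AcSelmer.bdpData (charModule ∅ θsub) p vbar) (↑Sf : Set (HeightOneSpectrum (𝓞 K))),
      Module.Finite (IwasawaAlgebra p) DS.X ∧ Module.IsTorsion (IwasawaAlgebra p) DS.X ∧ muInvariant p DS.X = 0 := fun DS ↦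
    ⟨(hsubP DS).1, (hsubP DS).2.1, (hsubP DS).2.2.1⟩
  have hSquot : ∀ DS : DatumDualData κ γ (charModule ∅ θquot)
      (AcSelmer.bdpData (charModule ∅ θquot) p vbar) (↑Sf : Set (HeightOneSpectrum (𝓞 K))),
      Module.Finite (IwasawaAlgebra p) DS.X ∧ Module.IsTorsion (IwasawaAlgebra p) DS.X ∧ muInvariant p DS.X = 0 := fun DS ↦
    ⟨(hquotP DS).1, (hquotP DS).2.1, (hquotP DS).2.2.1⟩
  have hlsub : lambdaInvariant p DSsub.X = lambdaInvariant p Dsub.X + ∑ w ∈ Sf, charLocalLambda ∅ κ θsub w := (hsubP DSsub).2.2.2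
  have hlquot : lambdaInvariant p DSquot.X = lambdaInvariant p Dquot.X + ∑ w ∈ Sf, charLocalLambda ∅ κ θquot w := (hquotP DSquot).2.2.2
  -- KY Thm. 1.4.1 (iii) at the split datum for the imprimitive duals
  have hmain := SplitMultSfTransfer.lambdaInvariant_add_le_of_split_offP_ofSurC h263 h41 h42 h5A h32 W p hp hsplitred K hK hCD2 hH hsplit htor ι v vbar
    hv hvbar hne κ hκ γ θsub θquot hpair hramI Sf hSf DSsub DSquot hfgS htorS hμS hSsub hSquot
  rw [hlsub, hlquot] at hmain
  rw [Finset.sum_add_distrib]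
  omega

end Summit.BirchSwinnertonDyer.BirchSwinnertonDyer.Theorems.SplitMultAlgebraicSide

end
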